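import Literature.Barriers.CriticalPhenomena.RigorousRGSmallParameterFRDScaleBounds
import Literature.Barriers.CriticalPhenomena.RigorousRGSmallParameterCovarianceIntegrals
import HarnessLib

/-!
# `RigorousRGSmallParameter` (Slade, Theorem 1.4.1): the covariance decomposition of the
# fractional Laplacian on `ℤ^d` and the scaling estimate (3.9) of Proposition 3.3.1 (`a = 0`),
# i.e. Proposition 10.1.1, display (10.3), without mass derivative

Companion of `RigorousRGSmallParameterFRDScaleBounds.lean` (the bounds (10.6)–(10.8) on the
finite-range decomposition `Γ_j(s)` of `(-Δ_{ℤ^d}+s)⁻¹`) and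
`RigorousRGSmallParameterCovarianceIntegrals.lean` ((10.9) and the elementary integrals of
Lemmas 10.1.3–10.1.4) in the proof architecture of the barrier `RigorousRGSmallParameter.lean`.
Source: G. Slade, *Critical exponents for long-range `O(n)` models below the upper critical
dimension*, Commun. Math. Phys. 358 (2018) 343–436: §3.2, display (3.8) "`C_{j;0,x} =
∫₀^∞ Γ_{j;0,x}(s) ρ^{(α/2)}(s,m²) ds`" (= (10.1)); Proposition 3.3.1 / Proposition 10.1.1:
"Let `d ≥ 1`, `α ∈ (0, 2∧d)`, `L ≥ 2`, `m² ∈ [0,∞)` … Let `j ≥ 1` for `ℤ^d` … for any `p' ≥ 0`,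
(10.3) `|∇^a C_{j;x,y}| ≤ c L^{-(d-α+|a|)(j-1)} (1/(1+m⁴L^{2α(j-1)}) + 1/(1+m²L^{p'(j-1)}))` …
The constant `c` may depend on `ā, p'`, but does not depend on `m², L, j, N`"; and its proof,
§10.1, displays (10.11)–(10.18) and the concluding displays for `j = 1` and `j ≥ 2`, `q = 0`
("consider the special term `S_0 = ∫₀^∞ ds ρ(s,A) ∫₀^{½} (dt/t) w(t,x;s)` … The typical term is
`T_j = ∫₀^∞ ds ρ(s,A) ∫_{J_j} (dt/t) w(t,x;s) = ∫₀^∞ ds ρ(s,A) ∫_{J_1} (dt/t) w(tL^{j-1},x;s)`. We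
decompose the `s`-integral as `∫₀^∞ = ∫₀^{L^{-2(j-1)}} + ∫_{L^{-2(j-1)}}^1 + ∫₁^∞`, and write this
decomposition as `T_j = T_{j,1} + T_{j,2} + T_{j,3}` … `A_j = AL^{α(j-1)}` … For `q = 0` this
simplifies to `|∇^a C_{j;0,x}| ≲ L^{-(d-2β+|a|)(j-1)} (1/(1+A_j²) + 1/(1+AL^{p'(j-1)}))`").
Here `a = 0` (no discrete gradients), `q = 0` (no mass derivative), on `ℤ^d` (the torus term
`C_{N,N}` of (10.4)/(3.10) is not treated), for the explicit [Baue13a]/BBS decomposition `Γ_j`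
of `RigorousRGSmallParameterFRDDecomposition`.

## What this file provides

* `FRD.fracCov d L α m2 j x` — **`C_{j;0,x}(m²) = ∫₀^∞ Γ_{j;0,x}(s) ρ^{(α/2)}(s,m²) ds`**, the
  terms of the covariance decomposition (3.7) of `((-Δ)^{α/2}+m²)⁻¹` on `ℤ^d` (definition with
  body; Slade (3.8) = (10.1)).
* `FRD.setIntegral_Ioc_comp_mul` (the change of variables `t = L^{j-1}τ` of (10.15)),
  `FRD.abs_setIntegral_le_of_abs_le`, `FRD.le_two_mul_div_one_add_sq`,
  `FRD.integrableOn_Ioc_of_continuousOn`, `FRD.Gam_eq_regular_add` ((10.6):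
  `Γ_j = ∫_{J_j} w dt/t + 𝟙_{j=1}∫₀^{½} w dt/t` with `J_j = L^{j-1}J_1`),
  `FRD.abs_regular_le_of_small_mass`, `FRD.abs_regular_le_of_large_mass` (the `t`-integral of
  (10.8) over `J_j`, rescaled to `J_1`), `FRD.continuousOn_J_integrand(')`,
  `FRD.sq_div_pow_div_le`, `FRD.exists_setIntegral_J_pow_le`, `FRD.exists_setIntegral_J_sq_le`,
  `FRD.exists_setIntegral_J_one_le` (the `t`-integrals over `J_1`:
  `∫_{J_1}(dt/t)t^{-2p}t^{2-d} ≲ 1`, `∫_{J_1}(dt/t)(1+σt²)^{-2}t^{2-d} ≲ σ⁻²`,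
  `∫_{J_1}(dt/t)(1+σt²)^{-1}t^{2-d} ≲ σ^{-θ_d}` for `σ ≤ 1` with `θ_1 = ½`, `θ_2 = ½(1-β)`,
  `θ_d = 0` (`d ≥ 3`) — Lemma 10.1.3 as used in (10.16)), `FRD.rpow_combine`,
  `FRD.pow_inv_mul_sq_div_pow`, `FRD.rpow_neg_div_one_add_le` (power counting in
  `ℓ = L^{j-1}`), `FRD.setIntegral_Ioi_eq_add_add` (the split `∫₀^∞ = ∫₀^{ℓ⁻²}+∫_{ℓ⁻²}^1+∫₁^∞`),
  `FRD.abs_special_le` (the special term `S_0`).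
* **`FRD.Slade2017_prop331_estimate_abs`**, **`FRD.Slade2017_prop331_estimate`** —
  **Proposition 3.3.1, estimate (3.9) = (10.3) with `a = 0`, on `ℤ^d`, PROVED** for the explicit
  construction: for `d ≥ 1`, `α ∈ (0,2∧d)` and `p' ≥ 0` there is `c` (independent of
  `m², L, j, x`) such that for all `L ≥ 2`, `m² ≥ 0`, `j ≥ 1`, `x ∈ ℤ^d`,
  `∫₀^∞|Γ_{j;0,x}(s)|ρ(s,m²)ds ≤ c (L^{j-1})^{α-d} (1/(1+m⁴(L^{j-1})^{2α}) + 1/(1+m²(L^{j-1})^{p'}))`,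
  hence the same bound for `|C_{j;0,x}(m²)|`.

Not treated: discrete gradients, the mass derivative (10.4), continuity in `m²`, the torus
term `C_{N,N}` and the identity `((-Δ)^{α/2}+m²)⁻¹ = Σ_j C_j` (3.7) itself (which needs the
measurability of `s ↦ Γ_j(s)`); no named fact is introduced.
-/

noncomputable section

namespace Literature.Barriers.CriticalPhenomena

open _root_.MeasureTheory Set Filter
open scoped _root_.Topology Real FourierTransform

namespace LongRangePhi4

namespace FRD

open Literature.Probability.LatticeModels

variable {d : ℕ}

/-! ### The terms `C_j` of the covariance decomposition on `ℤ^d` -/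

/-- **`C_{j;0,x}(m²) = ∫₀^∞ Γ_{j;0,x}(s) ρ^{(α/2)}(s,m²) ds`** — the `j`-th term of the
finite-range decomposition of `((-Δ_{ℤ^d})^{α/2}+m²)⁻¹` obtained by inserting `Γ = Σ_jΓ_j(s)`
into the Kato mixture (3.6) (Slade (3.8), repeated as (10.1)); as a translation-invariant kernel
`C_{j;x,y} = C_j(x-y)` on `ℤ^d`, for the explicit decomposition `Γ_j = FRD.Gam`.
[cite: Slade2017, §3.2 (display (3.8))] [cite: Slade2017, §10.1 (display (10.1))] -/
def fracCov (d : ℕ) (L α m2 : ℝ) (j : ℕ) (x : Site d) : ℝ :=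
  ∫ s in Ioi 0, Gam d L s j x * Kato.katoDensity (α / 2) m2 s

/-! ### Generic helpers -/

/-- Dilation of a set integral over `(ℓa,ℓb]`: `∫_{(ℓa,ℓb]} F = ℓ∫_{(a,b]} F(ℓτ)dτ` (`ℓ > 0`,
`a ≤ b`) — "the change of variables `τ = L^{j-1}t`" of (10.15).
[cite: Slade2017, §10.1 (display (10.15), change of variables)] -/
theorem setIntegral_Ioc_comp_mul {ℓ a b : ℝ} (hℓ : 0 < ℓ) (hab : a ≤ b) (F : ℝ → ℝ) :
    ∫ t in Ioc (ℓ * a) (ℓ * b), F t = ℓ * ∫ τ in Ioc a b, F (ℓ * τ) := by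
  rw [← intervalIntegral.integral_of_le (mul_le_mul_of_nonneg_left hab hℓ.le),
    ← intervalIntegral.smul_integral_comp_mul_left, intervalIntegral.integral_of_le hab, smul_eq_mul]

/-- `|∫_S f| ≤ ∫_S g` when `|f| ≤ g` on `S` and both are integrable there. [folklore] -/
theorem abs_setIntegral_le_of_abs_le {S : Set ℝ} (hS : MeasurableSet S) {f g : ℝ → ℝ}
    (hf : IntegrableOn f S) (hg : IntegrableOn g S) (h : ∀ s ∈ S, |f s| ≤ g s) :
    |∫ s in S, f s| ≤ ∫ s in S, g s :=
  abs_integral_le_integral_abs.trans (setIntegral_mono_on hf.abs hg hS h)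

/-- From the two regimes `X ≤ a` and `X ≤ aB⁻²` to `X ≤ 2a/(1+B²)` (the passage from
"`1 (A_j ≤ 1)`, `A_j^{-2} (A_j ≥ 1)`" to `1/(1+A_j²)` in the concluding displays of §10.1).
[cite: Slade2017, §10.1 (concluding display for q = 0: "this simplifies to … 1/(1+A_j²)")] -/
theorem le_two_mul_div_one_add_sq {X a B : ℝ} (ha : 0 ≤ a) (hB : 0 ≤ B) (h1 : X ≤ a)
    (h2 : 0 < B → X ≤ a * B⁻¹ ^ 2) : X ≤ 2 * a / (1 + B ^ 2) := by
  rcases le_or_gt B 1 with hB1 | hB1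
  · have : a ≤ 2 * a / (1 + B ^ 2) := by
      rw [le_div_iff₀ (by positivity)]
      nlinarith [pow_le_one₀ hB hB1 (n := 2)]
    linarith
  · have hB0 : 0 < B := by linarith
    have h := h2 hB0
    have : a * B⁻¹ ^ 2 ≤ 2 * a / (1 + B ^ 2) := by
      rw [inv_pow, ← div_eq_mul_inv, div_le_div_iff₀ (by positivity) (by positivity)]
      nlinarith [mul_le_mul_of_nonneg_left (one_le_pow₀ hB1.le : (1 : ℝ) ≤ B ^ 2) ha]
    linarith

/-- A continuous function on `[a,b]` (`a > 0` irrelevant) is integrable on `(a,b]`. [folklore] -/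
theorem integrableOn_Ioc_of_continuousOn {a b : ℝ} {F : ℝ → ℝ} (hF : ContinuousOn F (Icc a b)) :
    IntegrableOn F (Ioc a b) :=
  hF.integrableOn_Icc.mono_set Ioc_subset_Icc_self

/-! ### (10.6) with the regular part rescaled to `J_1 = (½, ½L]` -/

/-- **Slade (10.6) / (10.15)**: `Γ_j = ∫_{(½L^{j-1}, ½L^{j-1}L]} w dt/t + 𝟙_{j=1}∫_{(0,½]} w dt/t`
for `j ≥ 1`, `L ≥ 1`, `s > 0`. [cite: Slade2017, §10.1 (display (10.6))] -/
theorem Gam_eq_regular_add {L : ℝ} (hL : 1 ≤ L) {s : ℝ} (hs : 0 < s) {j : ℕ} (hj : 1 ≤ j)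
    (x : Site d) :
    Gam d L s j x = (∫ t in Ioc (L ^ (j - 1) / 2) (L ^ (j - 1) * L / 2), wKer d s t x / t) +
      (if j = 1 then ∫ t in Ioc 0 (1 / 2), wKer d s t x / t else 0) := by
  rcases Nat.lt_or_ge j 2 with hj1 | hj2
  · have hj' : j = 1 := by omega
    subst hj'
    rw [if_pos rfl, Gam_one_eq_add (b := 1 / 2) (by norm_num) (by linarith) hs x]
    simp
  · rw [if_neg (by omega), add_zero, Slade2017_display106 L s hj2 x]
    have hLj : L ^ j / 2 = L ^ (j - 1) * L / 2 := by
      rw [← pow_succ, Nat.sub_add_cancel hj]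
    rw [hLj]

/-- **The regular part in the small-mass regime**: if
`|w(t,x;s)| ≤ c(1+st²)^{-p}t^{2-d}` for `t ≥ ½`, `s ≤ 1` (Slade (10.8), second regime), then for
`ℓ ≥ 1`, `L ≥ 1`, `0 < s ≤ 1`:
`|∫_{(½ℓ,½ℓL]} w(t,x;s)dt/t| ≤ c ℓ^{2-d} ∫_{(½,½L]} (1+sℓ²τ²)^{-p}τ^{2-d} dτ/τ` ("`T_j = … =
∫ ds ρ ∫_{J_1} (dt/t) w(tL^{j-1},x;s)`" with (10.8) inserted).
[cite: Slade2017, §10.1 (displays (10.15)–(10.17): T_{j,1}, T_{j,2})] -/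
theorem abs_regular_le_of_small_mass {c : ℝ} {p : ℕ}
    (hw : ∀ s : ℝ, 0 < s → s ≤ 1 → ∀ t : ℝ, 1 / 2 ≤ t → ∀ x : Site d,
      |wKer d s t x| ≤ c * ((1 + s * t ^ 2) ^ p)⁻¹ * (t ^ 2 / t ^ d))
    {L : ℝ} (hL : 1 ≤ L) {ℓ : ℝ} (hℓ : 1 ≤ ℓ) {s : ℝ} (hs : 0 < s) (hs1 : s ≤ 1) (x : Site d) :
    |∫ t in Ioc (ℓ / 2) (ℓ * L / 2), wKer d s t x / t| ≤
      c * (ℓ ^ 2 / ℓ ^ d) *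
        ∫ τ in Ioc (1 / 2 : ℝ) (L / 2), ((1 + s * ℓ ^ 2 * τ ^ 2) ^ p)⁻¹ * (τ ^ 2 / τ ^ d) / τ := by
  have hℓ0 : 0 < ℓ := by linarith
  set F : ℝ → ℝ := fun t => c * ((1 + s * t ^ 2) ^ p)⁻¹ * (t ^ 2 / t ^ d) / t with hF
  have hFcont : ∀ a b : ℝ, 0 < a → ContinuousOn F (Icc a b) := by
    intro a b ha
    have hne : ∀ t ∈ Icc a b, t ≠ 0 := fun t ht => (lt_of_lt_of_le ha ht.1).ne'
    have hne' : ∀ t ∈ Icc a b, t ^ d ≠ 0 := fun t ht => pow_ne_zero d (hne t ht)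
    have hne'' : ∀ t ∈ Icc a b, (1 + s * t ^ 2) ^ p ≠ 0 := fun t _ => by positivity
    simp only [hF]
    exact (((continuousOn_const.mul ((continuousOn_const.add (continuousOn_const.mul
      (continuousOn_id.pow 2))).pow p |>.inv₀ hne'')).mul
      ((continuousOn_id.pow 2).div (continuousOn_id.pow d) hne')).div continuousOn_id hne)
  -- pointwise bound on `(½ℓ, ½ℓL]`
  have hpt : ∀ t ∈ Ioc (ℓ / 2) (ℓ * L / 2), |wKer d s t x / t| ≤ F t := by
    intro t ht
    have ht2 : 1 / 2 ≤ t := by linarith [ht.1]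
    have ht0 : 0 < t := by linarith
    rw [abs_div, abs_of_pos ht0]
    exact div_le_div_of_nonneg_right (hw s hs hs1 t ht2 x) ht0.le
  have hint : IntegrableOn (fun t : ℝ => wKer d s t x / t) (Ioc (ℓ / 2) (ℓ * L / 2)) :=
    integrableOn_wKer_div_Ioc hs x (by positivity)
  have hFint : IntegrableOn F (Ioc (ℓ / 2) (ℓ * L / 2)) :=
    integrableOn_Ioc_of_continuousOn (hFcont _ _ (by positivity))
  have h1 := abs_setIntegral_le_of_abs_le measurableSet_Ioc hint hFint hpt
  -- rescale
  have e1 : ℓ / 2 = ℓ * (1 / 2) := by ring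
  have e2 : ℓ * L / 2 = ℓ * (L / 2) := by ring
  have hscale : ∫ t in Ioc (ℓ / 2) (ℓ * L / 2), F t =
      c * (ℓ ^ 2 / ℓ ^ d) * ∫ τ in Ioc (1 / 2 : ℝ) (L / 2),
        ((1 + s * ℓ ^ 2 * τ ^ 2) ^ p)⁻¹ * (τ ^ 2 / τ ^ d) / τ := by
    rw [e1, e2, setIntegral_Ioc_comp_mul hℓ0 (by linarith) F, ← integral_const_mul,
      ← integral_const_mul]
    refine setIntegral_congr_fun measurableSet_Ioc fun τ hτ => ?_
    have hτ0 : 0 < τ := by linarith [hτ.1]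
    simp only [hF]
    have hP : (1 + s * (ℓ * τ) ^ 2) ^ p = (1 + s * ℓ ^ 2 * τ ^ 2) ^ p := by ring
    rw [hP, mul_pow, mul_pow]
    have hτd : τ ^ d ≠ 0 := (pow_pos hτ0 d).ne'
    have hℓd : ℓ ^ d ≠ 0 := (pow_pos hℓ0 d).ne'
    have hτ' : τ ≠ 0 := hτ0.ne'
    have hℓ' : ℓ ≠ 0 := hℓ0.ne'
    field_simp
  rw [hscale] at h1
  exact h1

/-- **The regular part in the large-mass regime**: if `|w(t,x;s)| ≤ cs⁻¹t^{-2p}t^{2-d}` for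
`t ≥ ½`, `s ≥ 1` (Slade (10.8), third regime), then for `ℓ ≥ 1`, `L ≥ 1`, `s ≥ 1`:
`|∫_{(½ℓ,½ℓL]} w(t,x;s)dt/t| ≤ c s⁻¹ ℓ^{-2p}ℓ^{2-d} ∫_{(½,½L]} τ^{-2p}τ^{2-d} dτ/τ`.
[cite: Slade2017, §10.1 (display (10.18): T_{j,3})] -/
theorem abs_regular_le_of_large_mass {c : ℝ} {p : ℕ}
    (hw : ∀ s : ℝ, 1 ≤ s → ∀ t : ℝ, 1 / 2 ≤ t → ∀ x : Site d,
      |wKer d s t x| ≤ c * s⁻¹ * (t ^ (2 * p))⁻¹ * (t ^ 2 / t ^ d))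
    {L : ℝ} (hL : 1 ≤ L) {ℓ : ℝ} (hℓ : 1 ≤ ℓ) {s : ℝ} (hs1 : 1 ≤ s) (x : Site d) :
    |∫ t in Ioc (ℓ / 2) (ℓ * L / 2), wKer d s t x / t| ≤
      c * s⁻¹ * ((ℓ ^ (2 * p))⁻¹ * (ℓ ^ 2 / ℓ ^ d)) *
        ∫ τ in Ioc (1 / 2 : ℝ) (L / 2), (τ ^ (2 * p))⁻¹ * (τ ^ 2 / τ ^ d) / τ := by
  have hℓ0 : 0 < ℓ := by linarith
  have hs : 0 < s := by linarith
  set F : ℝ → ℝ := fun t => c * s⁻¹ * (t ^ (2 * p))⁻¹ * (t ^ 2 / t ^ d) / t with hF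
  have hFcont : ∀ a b : ℝ, 0 < a → ContinuousOn F (Icc a b) := by
    intro a b ha
    have hne : ∀ t ∈ Icc a b, t ≠ 0 := fun t ht => (lt_of_lt_of_le ha ht.1).ne'
    have hne' : ∀ t ∈ Icc a b, t ^ d ≠ 0 := fun t ht => pow_ne_zero d (hne t ht)
    have hne'' : ∀ t ∈ Icc a b, t ^ (2 * p) ≠ 0 := fun t ht => pow_ne_zero _ (hne t ht)
    simp only [hF]
    exact (((continuousOn_const.mul ((continuousOn_id.pow (2 * p)).inv₀ hne'')).mul
      ((continuousOn_id.pow 2).div (continuousOn_id.pow d) hne')).div continuousOn_id hne)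
  have hpt : ∀ t ∈ Ioc (ℓ / 2) (ℓ * L / 2), |wKer d s t x / t| ≤ F t := by
    intro t ht
    have ht2 : 1 / 2 ≤ t := by linarith [ht.1]
    have ht0 : 0 < t := by linarith
    rw [abs_div, abs_of_pos ht0]
    exact div_le_div_of_nonneg_right (hw s hs1 t ht2 x) ht0.le
  have hint : IntegrableOn (fun t : ℝ => wKer d s t x / t) (Ioc (ℓ / 2) (ℓ * L / 2)) :=
    integrableOn_wKer_div_Ioc hs x (by positivity)
  have hFint : IntegrableOn F (Ioc (ℓ / 2) (ℓ * L / 2)) :=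
    integrableOn_Ioc_of_continuousOn (hFcont _ _ (by positivity))
  have h1 := abs_setIntegral_le_of_abs_le measurableSet_Ioc hint hFint hpt
  have e1 : ℓ / 2 = ℓ * (1 / 2) := by ring
  have e2 : ℓ * L / 2 = ℓ * (L / 2) := by ring
  have hscale : ∫ t in Ioc (ℓ / 2) (ℓ * L / 2), F t =
      c * s⁻¹ * ((ℓ ^ (2 * p))⁻¹ * (ℓ ^ 2 / ℓ ^ d)) *
        ∫ τ in Ioc (1 / 2 : ℝ) (L / 2), (τ ^ (2 * p))⁻¹ * (τ ^ 2 / τ ^ d) / τ := by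
    rw [e1, e2, setIntegral_Ioc_comp_mul hℓ0 (by linarith) F, ← integral_const_mul,
      ← integral_const_mul]
    refine setIntegral_congr_fun measurableSet_Ioc fun τ hτ => ?_
    have hτ0 : 0 < τ := by linarith [hτ.1]
    simp only [hF]
    rw [mul_pow, mul_pow, mul_pow]
    have hτd : τ ^ d ≠ 0 := (pow_pos hτ0 d).ne'
    have hℓd : ℓ ^ d ≠ 0 := (pow_pos hℓ0 d).ne'
    have hτp : τ ^ (2 * p) ≠ 0 := (pow_pos hτ0 _).ne'
    have hℓp : ℓ ^ (2 * p) ≠ 0 := (pow_pos hℓ0 _).ne'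
    have hτ' : τ ≠ 0 := hτ0.ne'
    have hℓ' : ℓ ≠ 0 := hℓ0.ne'
    field_simp
  rw [hscale] at h1
  exact h1

/-! ### The `t`-integrals over `J_1 = (½, ½L]` (Lemma 10.1.3 as used in (10.16)–(10.18)) -/

/-- Continuity of the rescaled integrands `(1+στ²)^{-p}τ^{2-d}/τ` on `[a,b]`, `a > 0`. [folklore] -/
theorem continuousOn_J_integrand {σ : ℝ} (hσ : 0 ≤ σ) (p : ℕ) {a b : ℝ} (ha : 0 < a) :
    ContinuousOn (fun τ : ℝ => ((1 + σ * τ ^ 2) ^ p)⁻¹ * (τ ^ 2 / τ ^ d) / τ) (Icc a b) := by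
  have hne : ∀ t ∈ Icc a b, t ≠ 0 := fun t ht => (lt_of_lt_of_le ha ht.1).ne'
  have hne' : ∀ t ∈ Icc a b, t ^ d ≠ 0 := fun t ht => pow_ne_zero d (hne t ht)
  have hne'' : ∀ t ∈ Icc a b, (1 + σ * t ^ 2) ^ p ≠ 0 := fun t _ => by positivity
  exact ((((continuousOn_const.add (continuousOn_const.mul (continuousOn_id.pow 2))).pow p
    |>.inv₀ hne'')).mul ((continuousOn_id.pow 2).div (continuousOn_id.pow d) hne')).div
    continuousOn_id hne

/-- Continuity of `τ^{-2p}τ^{2-d}/τ` on `[a,b]`, `a > 0`. [folklore] -/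
theorem continuousOn_J_integrand' (p : ℕ) {a b : ℝ} (ha : 0 < a) :
    ContinuousOn (fun τ : ℝ => (τ ^ (2 * p))⁻¹ * (τ ^ 2 / τ ^ d) / τ) (Icc a b) := by
  have hne : ∀ t ∈ Icc a b, t ≠ 0 := fun t ht => (lt_of_lt_of_le ha ht.1).ne'
  have hne' : ∀ t ∈ Icc a b, t ^ d ≠ 0 := fun t ht => pow_ne_zero d (hne t ht)
  have hne'' : ∀ t ∈ Icc a b, t ^ (2 * p) ≠ 0 := fun t ht => pow_ne_zero _ (hne t ht)
  exact ((((continuousOn_id.pow (2 * p)).inv₀ hne'')).mul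
    ((continuousOn_id.pow 2).div (continuousOn_id.pow d) hne')).div continuousOn_id hne

/-- On `τ ≥ ½`: `τ^{2-d}/τ = τ^{1-d} ≤ 2^{d-1}` (`d ≥ 1`). [folklore] -/
theorem sq_div_pow_div_le (hd : 1 ≤ d) {τ : ℝ} (hτ : 1 / 2 ≤ τ) : τ ^ 2 / τ ^ d / τ ≤ 2 ^ (d - 1) := by
  have hτ0 : 0 < τ := by linarith
  obtain ⟨k, rfl⟩ : ∃ k, d = k + 1 := ⟨d - 1, by omega⟩
  rw [Nat.add_sub_cancel, pow_succ, div_div, div_le_iff₀ (by positivity)]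
  have h2 : 1 ≤ (2 * τ) ^ k := one_le_pow₀ (by linarith)
  calc τ ^ 2 = 1 * τ * τ := by ring
    _ ≤ (2 * τ) ^ k * τ * τ := by gcongr
    _ = 2 ^ k * (τ ^ k * τ * τ) := by rw [mul_pow]; ring

/-- **`∫_{J_1}(dt/t) t^{-2p} t^{2-d} ≲ 1`** uniformly in `L` (`p ≥ 1`, `d ≥ 1`): the `t`-integral of
`T_{j,2}` and `T_{j,3}` ("`∫_{½}^∞ (dt/t) t^{-2p} t^{-(d-2+|a|)}`" in (10.17)).
[cite: Slade2017, §10.1 (display (10.17), the t-integral)] -/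
theorem exists_setIntegral_J_pow_le (hd : 1 ≤ d) {p : ℕ} (hp : 1 ≤ p) :
    ∃ K : ℝ, 0 < K ∧ ∀ L : ℝ, 1 ≤ L →
      ∫ τ in Ioc (1 / 2 : ℝ) (L / 2), (τ ^ (2 * p))⁻¹ * (τ ^ 2 / τ ^ d) / τ ≤ K := by
  have hexp : (-(2 * p : ℝ)) < -1 := by
    have : (1 : ℝ) ≤ p := by exact_mod_cast hp
    linarith
  set I : ℝ := ∫ τ in Ioi (1 / 2 : ℝ), τ ^ (-(2 * p : ℝ)) with hI
  have hIint : IntegrableOn (fun τ : ℝ => τ ^ (-(2 * p : ℝ))) (Ioi (1 / 2 : ℝ)) :=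
    integrableOn_Ioi_rpow_of_lt hexp (by norm_num)
  have hI0 : 0 ≤ I := setIntegral_nonneg measurableSet_Ioi fun τ hτ =>
    Real.rpow_nonneg (le_of_lt (lt_trans (by norm_num) hτ)) _
  refine ⟨2 ^ (d - 1) * I + 1, by positivity, fun L hL => ?_⟩
  have hpt : ∀ τ ∈ Ioc (1 / 2 : ℝ) (L / 2),
      (τ ^ (2 * p))⁻¹ * (τ ^ 2 / τ ^ d) / τ ≤ 2 ^ (d - 1) * τ ^ (-(2 * p : ℝ)) := by
    intro τ hτ
    have hτ0 : 0 < τ := by linarith [hτ.1]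
    have h1 := sq_div_pow_div_le hd hτ.1.le
    have h2 : (τ ^ (2 * p))⁻¹ = τ ^ (-(2 * p : ℝ)) := by
      rw [Real.rpow_neg hτ0.le, ← Real.rpow_natCast]
      norm_num
    rw [mul_div_assoc, h2, mul_comm]
    exact mul_le_mul_of_nonneg_right h1 (Real.rpow_nonneg hτ0.le _)
  have hg : IntegrableOn (fun τ : ℝ => 2 ^ (d - 1) * τ ^ (-(2 * p : ℝ))) (Ioc (1 / 2 : ℝ) (L / 2)) :=
    (hIint.mono_set Ioc_subset_Ioi_self).const_mul _
  calc ∫ τ in Ioc (1 / 2 : ℝ) (L / 2), (τ ^ (2 * p))⁻¹ * (τ ^ 2 / τ ^ d) / τ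
      ≤ ∫ τ in Ioc (1 / 2 : ℝ) (L / 2), 2 ^ (d - 1) * τ ^ (-(2 * p : ℝ)) :=
        setIntegral_mono_on (integrableOn_Ioc_of_continuousOn (continuousOn_J_integrand' p
          (by norm_num))) hg measurableSet_Ioc hpt
    _ ≤ ∫ τ in Ioi (1 / 2 : ℝ), 2 ^ (d - 1) * τ ^ (-(2 * p : ℝ)) := by
        refine setIntegral_mono_set (hIint.const_mul _) ?_ Ioc_subset_Ioi_self.eventuallyLE
        refine (ae_restrict_iff' measurableSet_Ioi).2 (Eventually.of_forall fun τ hτ => ?_)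
        have : (0 : ℝ) < τ := lt_trans (by norm_num) hτ
        positivity
    _ = 2 ^ (d - 1) * I := integral_const_mul _ _
    _ ≤ 2 ^ (d - 1) * I + 1 := by linarith

/-- **`∫_{J_1}(dt/t)(1+σt²)^{-2}t^{2-d} ≲ σ⁻²`** uniformly in `L` (`σ > 0`, `d ≥ 1`): the
`t`-integral of `T_{j,2}` ("do not put `p = 1`": `(1+σt²)^{-p} ≤ σ^{-p}t^{-2p}`).
[cite: Slade2017, §10.1 (display (10.17))] -/
theorem exists_setIntegral_J_sq_le (hd : 1 ≤ d) :
    ∃ K : ℝ, 0 < K ∧ ∀ σ : ℝ, 0 < σ → ∀ L : ℝ, 1 ≤ L →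
      ∫ τ in Ioc (1 / 2 : ℝ) (L / 2), ((1 + σ * τ ^ 2) ^ 2)⁻¹ * (τ ^ 2 / τ ^ d) / τ ≤
        K * (σ ^ 2)⁻¹ := by
  obtain ⟨K, hK, h⟩ := exists_setIntegral_J_pow_le hd (p := 2) (by norm_num)
  refine ⟨K, hK, fun σ hσ L hL => ?_⟩
  have hpt : ∀ τ ∈ Ioc (1 / 2 : ℝ) (L / 2),
      ((1 + σ * τ ^ 2) ^ 2)⁻¹ * (τ ^ 2 / τ ^ d) / τ ≤
        (σ ^ 2)⁻¹ * ((τ ^ (2 * 2))⁻¹ * (τ ^ 2 / τ ^ d) / τ) := by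
    intro τ hτ
    have hτ0 : 0 < τ := by linarith [hτ.1]
    have h0 : 0 ≤ τ ^ 2 / τ ^ d / τ := by positivity
    have h1 : ((1 + σ * τ ^ 2) ^ 2)⁻¹ ≤ (σ ^ 2)⁻¹ * (τ ^ (2 * 2))⁻¹ := by
      have e : (σ ^ 2)⁻¹ * (τ ^ (2 * 2))⁻¹ = ((σ * τ ^ 2) ^ 2)⁻¹ := by
        rw [← mul_inv]
        congr 1
        ring
      rw [e]
      apply inv_anti₀ (by positivity)
      apply pow_le_pow_left₀ (by positivity)
      linarith
    calc ((1 + σ * τ ^ 2) ^ 2)⁻¹ * (τ ^ 2 / τ ^ d) / τ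
        = ((1 + σ * τ ^ 2) ^ 2)⁻¹ * (τ ^ 2 / τ ^ d / τ) := by ring
      _ ≤ (σ ^ 2)⁻¹ * (τ ^ (2 * 2))⁻¹ * (τ ^ 2 / τ ^ d / τ) :=
          mul_le_mul_of_nonneg_right h1 h0
      _ = (σ ^ 2)⁻¹ * ((τ ^ (2 * 2))⁻¹ * (τ ^ 2 / τ ^ d) / τ) := by ring
  have hg : IntegrableOn (fun τ : ℝ => (σ ^ 2)⁻¹ * ((τ ^ (2 * 2))⁻¹ * (τ ^ 2 / τ ^ d) / τ))
      (Ioc (1 / 2 : ℝ) (L / 2)) :=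
    (integrableOn_Ioc_of_continuousOn (continuousOn_J_integrand' 2 (by norm_num))).const_mul _
  calc ∫ τ in Ioc (1 / 2 : ℝ) (L / 2), ((1 + σ * τ ^ 2) ^ 2)⁻¹ * (τ ^ 2 / τ ^ d) / τ
      ≤ ∫ τ in Ioc (1 / 2 : ℝ) (L / 2), (σ ^ 2)⁻¹ * ((τ ^ (2 * 2))⁻¹ * (τ ^ 2 / τ ^ d) / τ) :=
        setIntegral_mono_on (integrableOn_Ioc_of_continuousOn (continuousOn_J_integrand hσ.le 2
          (by norm_num))) hg measurableSet_Ioc hpt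
    _ = (σ ^ 2)⁻¹ * ∫ τ in Ioc (1 / 2 : ℝ) (L / 2), (τ ^ (2 * 2))⁻¹ * (τ ^ 2 / τ ^ d) / τ :=
        integral_const_mul _ _
    _ ≤ (σ ^ 2)⁻¹ * K := mul_le_mul_of_nonneg_left (h L hL) (by positivity)
    _ = K * (σ ^ 2)⁻¹ := mul_comm _ _

/-- **Lemma 10.1.3 as used in (10.16): `∫_{J_1}(dt/t)(1+σt²)^{-1}t^{2-d} ≲ σ^{-θ_d}` for
`σ ∈ (0,1]`**, uniformly in `L`, with `θ_1 = ½` (`I(1,s) ≲ s^{-1/2}`), `θ_2 = ½(1-β)` (any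
positive power replaces the corrected `1 + log s⁻¹` of `d = 2`), `θ_d = 0` for `d ≥ 3`
(`I(d,s) ≲ 1`); in all cases `θ_d + β < 1` provided `2β < d` (i.e. `α < d`, which for `d = 1`
is the hypothesis `α < 1` making `γ_1 = β - ½` admissible).
[cite: Slade2017, §10.1 (Lemma 10.1.3; display (10.16), γ_1 = β - ½, γ_2, γ_d = β)] -/
theorem exists_setIntegral_J_one_le (hd : 1 ≤ d) {β : ℝ} (hβ0 : 0 < β) (hβ1 : β < 1)
    (hβd : 2 * β < d) :
    ∃ θ K : ℝ, 0 ≤ θ ∧ θ + β < 1 ∧ 0 < K ∧ ∀ σ : ℝ, 0 < σ → σ ≤ 1 → ∀ L : ℝ, 1 ≤ L →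
      ∫ τ in Ioc (1 / 2 : ℝ) (L / 2), ((1 + σ * τ ^ 2) ^ 1)⁻¹ * (τ ^ 2 / τ ^ d) / τ ≤
        K * σ ^ (-θ) := by
  rcases Nat.lt_or_ge d 2 with hd1 | hd2
  · -- `d = 1`
    have hd' : d = 1 := by omega
    subst hd'
    have hβ2 : β < 1 / 2 := by
      have : (2 : ℝ) * β < 1 := by exact_mod_cast hβd
      linarith
    refine ⟨1 / 2, π / 2, by norm_num, by linarith, by positivity, fun σ hσ _ L hL => ?_⟩
    have he : EqOn (fun τ : ℝ => ((1 + σ * τ ^ 2) ^ 1)⁻¹ * (τ ^ 2 / τ ^ 1) / τ)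
        (fun τ => (1 + σ * τ ^ 2)⁻¹) (Ioc (1 / 2 : ℝ) (L / 2)) := fun τ hτ => by
      have hτ0 : (τ : ℝ) ≠ 0 := by linarith [hτ.1]
      simp only [pow_one]
      field_simp
    rw [setIntegral_congr_fun measurableSet_Ioc he]
    refine (CovBound.setIntegral_inv_one_add_mul_sq_le hσ (by linarith)).trans (le_of_eq ?_)
    rw [Real.sqrt_eq_rpow, Real.rpow_neg hσ.le, div_eq_mul_inv]
  rcases Nat.lt_or_ge d 3 with hd2' | hd3
  · -- `d = 2`
    have hd' : d = 2 := by omega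
    subst hd'
    set θ : ℝ := (1 - β) / 2 with hθ
    have hθ0 : 0 < θ := by rw [hθ]; linarith
    refine ⟨θ, 5 ^ θ / (2 * θ), hθ0.le, by rw [hθ]; linarith, by positivity,
      fun σ hσ hσ1 L hL => ?_⟩
    have he : EqOn (fun τ : ℝ => ((1 + σ * τ ^ 2) ^ 1)⁻¹ * (τ ^ 2 / τ ^ 2) / τ)
        (fun τ => (τ * (1 + σ * τ ^ 2))⁻¹) (Ioc (1 / 2 : ℝ) (L / 2)) := fun τ hτ => by
      have hτ0 : (τ : ℝ) ≠ 0 := by linarith [hτ.1]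
      have hτ2 : (τ : ℝ) ^ 2 ≠ 0 := pow_ne_zero 2 hτ0
      simp only [pow_one]
      field_simp
    rw [setIntegral_congr_fun measurableSet_Ioc he]
    exact (CovBound.setIntegral_inv_mul_one_add_mul_sq_le hσ (by linarith)).trans
      (CovBound.log_le_rpow_neg hσ hσ1 hθ0)
  · -- `d ≥ 3`
    refine ⟨0, 2 ^ (d - 2), le_rfl, by linarith, by positivity, fun σ hσ _ L hL => ?_⟩
    rw [neg_zero, Real.rpow_zero, mul_one]
    have hpt : ∀ τ ∈ Ioc (1 / 2 : ℝ) (L / 2),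
        ((1 + σ * τ ^ 2) ^ 1)⁻¹ * (τ ^ 2 / τ ^ d) / τ ≤ τ / τ ^ d := by
      intro τ hτ
      have hτ0 : 0 < τ := by linarith [hτ.1]
      have h1 : ((1 + σ * τ ^ 2) ^ 1)⁻¹ ≤ 1 := by
        rw [pow_one]
        apply inv_le_one_of_one_le₀
        nlinarith [mul_nonneg hσ.le (sq_nonneg τ)]
      have h2 : τ ^ 2 / τ ^ d / τ = τ / τ ^ d := by
        field_simp
      calc ((1 + σ * τ ^ 2) ^ 1)⁻¹ * (τ ^ 2 / τ ^ d) / τ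
          = ((1 + σ * τ ^ 2) ^ 1)⁻¹ * (τ ^ 2 / τ ^ d / τ) := by ring
        _ ≤ 1 * (τ ^ 2 / τ ^ d / τ) := mul_le_mul_of_nonneg_right h1 (by positivity)
        _ = τ / τ ^ d := by rw [one_mul, h2]
    calc ∫ τ in Ioc (1 / 2 : ℝ) (L / 2), ((1 + σ * τ ^ 2) ^ 1)⁻¹ * (τ ^ 2 / τ ^ d) / τ
        ≤ ∫ τ in Ioc (1 / 2 : ℝ) (L / 2), τ / τ ^ d :=
          setIntegral_mono_on (integrableOn_Ioc_of_continuousOn (continuousOn_J_integrand hσ.le 1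
            (by norm_num))) (integrableOn_div_pow_Ioc (by norm_num)) measurableSet_Ioc hpt
      _ ≤ 2 ^ (d - 2) := scaleIntegral_le hd3 hL

/-! ### Power-counting helpers (`ℓ = L^{j-1}`) -/

/-- `ℓ^{2-d} (ℓ²)^{e₁} (ℓ^{-2})^{e₂} = ℓ^{2+2e₁-2e₂-d}`. [folklore] -/
theorem rpow_combine {ℓ : ℝ} (hℓ : 0 < ℓ) (e₁ e₂ : ℝ) :
    ℓ ^ 2 / ℓ ^ d * (ℓ ^ 2) ^ e₁ * ((ℓ ^ 2)⁻¹) ^ e₂ = ℓ ^ (2 + 2 * e₁ - 2 * e₂ - d : ℝ) := by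
  have hu : 0 ≤ ℓ ^ 2 := by positivity
  rw [Real.inv_rpow hu, ← Real.rpow_neg hu, ← Real.rpow_natCast ℓ 2, ← Real.rpow_mul hℓ.le,
    ← Real.rpow_mul hℓ.le, ← Real.rpow_natCast ℓ d, div_eq_mul_inv, ← Real.rpow_neg hℓ.le,
    ← Real.rpow_add hℓ, ← Real.rpow_add hℓ, ← Real.rpow_add hℓ]
  congr 1
  push_cast
  ring

/-- `ℓ^{-2p} ℓ^{2-d} = ℓ^{2-2p-d}`. [folklore] -/
theorem pow_inv_mul_sq_div_pow {ℓ : ℝ} (hℓ : 0 < ℓ) (p : ℕ) :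
    (ℓ ^ (2 * p))⁻¹ * (ℓ ^ 2 / ℓ ^ d) = ℓ ^ (2 - 2 * p - d : ℝ) := by
  rw [← Real.rpow_natCast ℓ (2 * p), ← Real.rpow_natCast ℓ 2, ← Real.rpow_natCast ℓ d,
    ← Real.rpow_neg hℓ.le, div_eq_mul_inv, ← Real.rpow_neg hℓ.le, ← Real.rpow_add hℓ,
    ← Real.rpow_add hℓ]
  congr 1
  push_cast
  ring

/-- `ℓ^{-q}/(1+A) ≤ 1/(1+Aℓ^{p'})` for `ℓ ≥ 1`, `0 ≤ p' ≤ q`, `A ≥ 0` (the last term of (10.18):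
`L^{-p'(j-1)} I_2(β-1,β,0,A) ≲ 1/(1+AL^{p'(j-1)})`). [cite: Slade2017, §10.1 (display (10.18) and the concluding display for q = 0)] -/
theorem rpow_neg_div_one_add_le {ℓ q p' A : ℝ} (hℓ : 1 ≤ ℓ) (hp' : 0 ≤ p') (hq : p' ≤ q)
    (hA : 0 ≤ A) : ℓ ^ (-q) / (1 + A) ≤ 1 / (1 + A * ℓ ^ p') := by
  have hℓ0 : 0 < ℓ := by linarith
  have h1 : ℓ ^ (-q) ≤ 1 := Real.rpow_le_one_of_one_le_of_nonpos hℓ (by linarith)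
  have h2 : ℓ ^ (-q) * ℓ ^ p' ≤ 1 := by
    rw [← Real.rpow_add hℓ0]
    exact Real.rpow_le_one_of_one_le_of_nonpos hℓ (by linarith)
  have hp0 : 0 < ℓ ^ p' := Real.rpow_pos_of_pos hℓ0 _
  rw [div_le_div_iff₀ (by positivity) (by positivity), one_mul]
  nlinarith [mul_le_mul_of_nonneg_left h2 hA, Real.rpow_nonneg hℓ0.le (-q)]

/-- Splitting `∫_{(0,∞)} = ∫_{(0,T]} + ∫_{(T,1]} + ∫_{(1,∞)}` for an integrable `f` and
`0 ≤ T ≤ 1` ("We decompose the `s`-integral as `∫₀^∞ = ∫₀^{L^{-2(j-1)}} + ∫_{L^{-2(j-1)}}^1 +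
∫₁^∞`"). [cite: Slade2017, §10.1 (decomposition T_j = T_{j,1} + T_{j,2} + T_{j,3})] -/
theorem setIntegral_Ioi_eq_add_add {f : ℝ → ℝ} (hf : IntegrableOn f (Ioi 0)) {T : ℝ}
    (hT0 : 0 ≤ T) (hT1 : T ≤ 1) :
    ∫ s in Ioi 0, f s = (∫ s in Ioc 0 T, f s) + (∫ s in Ioc T 1, f s) + ∫ s in Ioi 1, f s := by
  have hu1 : Ioc (0 : ℝ) T ∪ Ioc T 1 = Ioc 0 1 := Ioc_union_Ioc_eq_Ioc hT0 hT1
  have hu2 : Ioc (0 : ℝ) 1 ∪ Ioi 1 = Ioi 0 := Ioc_union_Ioi_eq_Ioi zero_le_one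
  have hd2 : Disjoint (Ioc (0 : ℝ) 1) (Ioi 1) :=
    Set.disjoint_left.2 fun s hs hs' => not_lt.2 hs.2 hs'
  rw [← hu2, setIntegral_union hd2 measurableSet_Ioi (hf.mono_set (by rw [← hu2]; exact
    subset_union_left)) (hf.mono_set (by rw [← hu2]; exact subset_union_right)), ← hu1,
    setIntegral_union (Ioc_disjoint_Ioc_of_le le_rfl) measurableSet_Ioc
      (hf.mono_set (by rw [← hu2, ← hu1]; exact subset_union_left.trans subset_union_left))
      (hf.mono_set (by rw [← hu2, ← hu1]; exact subset_union_right.trans subset_union_left))]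

/-- The special term of (10.6): `|∫_{(0,½]} w(t,x;s)dt/t| ≤ ½|f̂(0)/2πc|/(2d+s)` (`s > 0`).
[cite: Slade2017, §10.1 (display (10.11), the special term S_0)] -/
theorem abs_special_le {s : ℝ} (hs : 0 < s) (x : Site d) :
    |∫ t in Ioc 0 (1 / 2), wKer d s t x / t| ≤
      |(𝓕 (profile : ℝ → ℂ) 0).re / (2 * π * cProfile)| / 2 * (1 / (2 * d + s)) := by
  rw [setIntegral_wKer_div_Ioc_of_le_one s (by norm_num) (by norm_num) x]
  have hM : (0 : ℝ) < 2 * d + s := by positivity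
  have hδ : |(if x = 0 then (1 : ℝ) else 0)| ≤ 1 := by split_ifs <;> simp
  rw [abs_mul, abs_mul, abs_mul, abs_of_pos (by positivity : (0 : ℝ) < 1 / 2),
    abs_of_pos (by positivity : (0 : ℝ) < 1 / (2 * d + s))]
  calc 1 / 2 * (1 / (2 * d + s) * |(𝓕 (profile : ℝ → ℂ) 0).re / (2 * π * cProfile)| *
        |(if x = 0 then (1 : ℝ) else 0)|)
      ≤ 1 / 2 * (1 / (2 * d + s) * |(𝓕 (profile : ℝ → ℂ) 0).re / (2 * π * cProfile)| * 1) := by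
        gcongr
    _ = _ := by ring

/-! ### Proposition 3.3.1 / 10.1.1, estimate (3.9) = (10.3), `a = 0`, on `ℤ^d` -/

-- Budget: this proof measures ≈ 201 800 heartbeats when elaborated synchronously
-- (`set_option Elab.async false` + `#count_heartbeats in`, 2026-08-16), i.e. just above the default
-- 200 000: the full `lake build` failed deterministically (whnf/isDefEq/tactic timeouts reported at
-- 501:0, 918:74, 935:6) while the asynchronous `lean` CLI elaboration used by the gate passed.
-- Doubling the budget is the standard remedy (proof text unchanged).
set_option maxHeartbeats 400000 in
/-- **Slade, Proposition 3.3.1 (3.9) = Proposition 10.1.1 (10.3) with `a = 0` (no gradients,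
no mass derivative), on `ℤ^d`, PROVED for the explicit [Baue13a]/BBS decomposition**: for
`d ≥ 1`, `α ∈ (0, 2∧d)` and `p' ≥ 0` there is `c > 0` — independent of `m², L, j, x` — such
that for all `L ≥ 2`, `m² ≥ 0`, `j ≥ 1`, `x ∈ ℤ^d`:
`|C_{j;0,x}(m²)| ≤ c (L^{j-1})^{α-d} (1/(1+m⁴(L^{j-1})^{2α}) + 1/(1+m²(L^{j-1})^{p'}))`, i.e.
"`|C_{j;x,y}| ≤ cL^{-(d-α)(j-1)}(1/(1+m⁴L^{2α(j-1)}) + 1/(1+m²L^{p'(j-1)}))`". Printed proof,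
followed (§10.1): `C_j = S_0𝟙_{j=1} + T_j`, `T_j = T_{j,1}+T_{j,2}+T_{j,3}` by splitting the
`s`-integral at `L^{-2(j-1)}` and `1`; (10.8) in the three regimes (`p = 1`, `p = 2`, and `p`
with `2p-2+α ≥ p'`), the change of variables `t = L^{j-1}τ`, Lemma 10.1.3 for the `t`-integrals,
(10.9) and Lemma 10.1.4 for the `s`-integrals (here by direct comparison, with the corrections
recorded in `RigorousRGSmallParameterCovarianceIntegrals`), and `A_j = m²L^{α(j-1)}`. This is the
version with the absolute value INSIDE the `s`-integral (which is what the printed proof bounds,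
and what the torus term `C_{N,N}` of (3.10) needs); `Slade2017_prop331_estimate` below is the
printed form. [cite: Slade2017, Proposition 3.3.1 (display (3.9), a = 0)] [cite: Slade2017, §10.1 (Proposition 10.1.1, display (10.3), a = 0; proof, displays (10.11)–(10.18))] -/
theorem Slade2017_prop331_estimate_abs (hd : 1 ≤ d) {α : ℝ} (hα0 : 0 < α) (hα2 : α < 2)
    (hαd : α < d) {p' : ℝ} (hp' : 0 ≤ p') :
    ∃ c : ℝ, 0 < c ∧ ∀ L : ℝ, 2 ≤ L → ∀ m2 : ℝ, 0 ≤ m2 → ∀ j : ℕ, 1 ≤ j → ∀ x : Site d,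
      ∫ s in Ioi 0, |Gam d L s j x| * Kato.katoDensity (α / 2) m2 s ≤ c * (L ^ (j - 1)) ^ (α - d) *
        (1 / (1 + m2 ^ 2 * (L ^ (j - 1)) ^ (2 * α)) + 1 / (1 + m2 * (L ^ (j - 1)) ^ p')) := by
  -- parameters
  set β : ℝ := α / 2 with hβ
  have hβ0 : 0 < β := by positivity
  have hβ1 : β < 1 := by rw [hβ]; linarith
  have hβd : 2 * β < d := by rw [hβ]; linarith
  have hαβ : α = 2 * β := by rw [hβ]; ring
  -- Kato's density
  set cρ : ℝ := 2 * Real.sin (π * β) / (π * (1 + Real.cos (π * β))) with hcρ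
  have hsin : 0 < Real.sin (π * β) := Real.sin_pos_of_pos_of_lt_pi (by positivity)
    (by nlinarith [Real.pi_pos])
  have hcos := Kato.one_add_cos_pos hβ0 hβ1
  have hcρ0 : 0 < cρ := by positivity
  have hρ : ∀ {A s : ℝ}, 0 ≤ A → 0 < s →
      Kato.katoDensity (α / 2) A s ≤ cρ * (s ^ β / (s ^ β + A) ^ 2) := fun hA hs =>
    Kato.katoDensity_le_rpow_div_sq hβ0 hβ1 hA hs
  have hρ0 : ∀ {A s : ℝ}, 0 < s → 0 ≤ Kato.katoDensity (α / 2) A s := fun hs =>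
    (Kato.katoDensity_pos hβ0 hβ1 _ hs).le
  -- the bounds (10.8) on `w`
  obtain ⟨c₁, hc₁, hw₁⟩ := Slade2017_display108_small_mass hd 1
  obtain ⟨c₂, hc₂, hw₂⟩ := Slade2017_display108_small_mass hd 2
  obtain ⟨p₃, hp₃1, hp₃⟩ : ∃ p₃ : ℕ, 1 ≤ p₃ ∧ p' ≤ 2 * p₃ - 2 + α := by
    obtain ⟨n, hn⟩ := exists_nat_ge (p' / 2 + 1)
    refine ⟨n + 1, by omega, ?_⟩
    push_cast
    linarith
  obtain ⟨c₃, hc₃, hw₃⟩ := Slade2017_display108_large_mass hd p₃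
  -- the `t`-integrals over `J_1`
  obtain ⟨θ, K₁, hθ0, hθβ, hK₁, hJ₁⟩ := exists_setIntegral_J_one_le hd hβ0 hβ1 hβd
  obtain ⟨K₂, hK₂, hJ₂⟩ := exists_setIntegral_J_sq_le hd
  obtain ⟨K₃, hK₃, hJ₃⟩ := exists_setIntegral_J_pow_le hd hp₃1
  -- constants
  set κ : ℝ := |(𝓕 (profile : ℝ → ℂ) 0).re / (2 * π * cProfile)| with hκ
  have hκ0 : 0 ≤ κ := abs_nonneg _
  set M₁ : ℝ := c₁ * K₁ + κ / 2 with hM₁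
  set M₂ : ℝ := c₂ * K₂ + κ / 2 with hM₂
  set M₃ : ℝ := c₃ * K₃ + κ / 2 with hM₃
  have hM₁0 : 0 < M₁ := by positivity
  have hM₂0 : 0 < M₂ := by positivity
  have hM₃0 : 0 < M₃ := by positivity
  have he₁ : 0 < 1 - β - θ := by linarith
  have he₂ : 0 < 1 + β - θ := by linarith
  have he₃ : 0 < 1 - β := by linarith
  set a₁ : ℝ := M₁ * cρ * (1 / (1 - β - θ) + 1 / (1 + β - θ)) with ha₁
  set a₂ : ℝ := M₂ * cρ * (1 / (β + 1) + 1 / (1 - β)) with ha₂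
  set a₃ : ℝ := M₃ * cρ / β with ha₃
  have ha₁0 : 0 < a₁ := by positivity
  have ha₂0 : 0 < a₂ := by positivity
  have ha₃0 : 0 < a₃ := by positivity
  refine ⟨2 * a₁ + 2 * a₂ + a₃, by positivity, fun L hL m2 hm2 j hj x => ?_⟩
  -- notation for this `L, m², j, x`
  have hL1 : (1 : ℝ) ≤ L := by linarith
  set A : ℝ := m2 with hA
  set ℓ : ℝ := L ^ (j - 1) with hℓ
  have hℓ1 : 1 ≤ ℓ := one_le_pow₀ hL1
  have hℓ0 : 0 < ℓ := by linarith
  have hℓj : j = 1 → ℓ = 1 := fun h => by rw [hℓ, h]; simp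
  set T : ℝ := (ℓ ^ 2)⁻¹ with hT
  have hT0 : 0 < T := by positivity
  have hT1 : T ≤ 1 := inv_le_one_of_one_le₀ (one_le_pow₀ hℓ1)
  set P : ℝ := ℓ ^ (α - d : ℝ) with hP
  have hP0 : 0 < P := Real.rpow_pos_of_pos hℓ0 _
  set Aj : ℝ := A * ℓ ^ α with hAj
  have hAj0 : 0 ≤ Aj := mul_nonneg hm2 (Real.rpow_nonneg hℓ0.le _)
  have hAj2 : Aj ^ 2 = A ^ 2 * ℓ ^ (2 * α) := by
    rw [hAj, mul_pow, ← Real.rpow_natCast (ℓ ^ α) 2, ← Real.rpow_mul hℓ0.le]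
    push_cast
    ring_nf
  have hfinal : ∀ {X₁ X₂ X₃ : ℝ}, X₁ ≤ 2 * (a₁ * P) / (1 + Aj ^ 2) → X₂ ≤ 2 * (a₂ * P) / (1 + Aj ^ 2) →
      X₃ ≤ a₃ * P * (1 / (1 + A * ℓ ^ p')) →
      X₁ + X₂ + X₃ ≤ (2 * a₁ + 2 * a₂ + a₃) * P *
        (1 / (1 + A ^ 2 * ℓ ^ (2 * α)) + 1 / (1 + A * ℓ ^ p')) := by
    intro X₁ X₂ X₃ h1 h2 h3
    rw [← hAj2]
    have hF1 : 0 ≤ 1 / (1 + Aj ^ 2) := by positivity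
    have hF2 : 0 ≤ 1 / (1 + A * ℓ ^ p') := by
      have := Real.rpow_nonneg hℓ0.le p'
      positivity
    have e : (2 * a₁ + 2 * a₂ + a₃) * P * (1 / (1 + Aj ^ 2) + 1 / (1 + A * ℓ ^ p')) =
        2 * (a₁ * P) / (1 + Aj ^ 2) + 2 * (a₂ * P) / (1 + Aj ^ 2) + a₃ * P * (1 / (1 + A * ℓ ^ p')) +
          ((2 * a₁ + 2 * a₂) * P * (1 / (1 + A * ℓ ^ p')) + a₃ * P * (1 / (1 + Aj ^ 2))) := by
      ring
    rw [e]
    have : 0 ≤ (2 * a₁ + 2 * a₂) * P * (1 / (1 + A * ℓ ^ p')) + a₃ * P * (1 / (1 + Aj ^ 2)) := by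
      positivity
    linarith
  -- the integrand; make the abbreviations opaque (cheap definitional unfolding only via equations)
  set f : ℝ → ℝ := fun s => |Gam d L s j x| * Kato.katoDensity (α / 2) m2 s with hf
  clear_value f Aj P T ℓ a₁ a₂ a₃ M₁ M₂ M₃ κ cρ β
  show ∫ s in Ioi 0, f s ≤ _
  by_cases hint : IntegrableOn f (Ioi 0)
  swap
  · rw [integral_undef hint]
    have := Real.rpow_nonneg hℓ0.le p'
    have := Real.rpow_nonneg hℓ0.le (2 * α)
    positivity
  -- Step 1: `Γ_j = R + 𝟙_{j=1}S` (10.6), and pointwise bounds on `|Γ_j(s)|` in the three regimes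
  have hGam : ∀ s : ℝ, 0 < s → Gam d L s j x =
      (∫ t in Ioc (ℓ / 2) (ℓ * L / 2), wKer d s t x / t) +
        (if j = 1 then ∫ t in Ioc 0 (1 / 2), wKer d s t x / t else 0) := fun s hs => by
    have := Gam_eq_regular_add hL1 hs hj x
    rwa [← hℓ] at this
  have hfac : 0 ≤ ℓ ^ 2 / ℓ ^ d := by positivity
  have hfac1 : j = 1 → ℓ ^ 2 / ℓ ^ d = 1 := fun h => by rw [hℓj h]; simp
  have hSle : ∀ s : ℝ, 0 < s → j = 1 →
      |∫ t in Ioc 0 (1 / 2), wKer d s t x / t| ≤ κ / 2 * s⁻¹ ∧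
      |∫ t in Ioc 0 (1 / 2), wKer d s t x / t| ≤ κ / 2 := by
    intro s hs _
    have h := abs_special_le hs x
    rw [← hκ] at h
    have hd' : (1 : ℝ) ≤ d := by exact_mod_cast hd
    constructor
    · refine h.trans (mul_le_mul_of_nonneg_left ?_ (by positivity))
      rw [one_div]
      exact inv_anti₀ hs (by linarith)
    · refine h.trans (mul_le_of_le_one_right (by positivity) ?_)
      rw [div_le_one (by positivity)]
      linarith
  -- (i) `s ≤ T = L^{-2(j-1)}` (hence `sℓ² ≤ 1`): (10.8) with `p = 1`
  have hG1 : ∀ s : ℝ, 0 < s → s ≤ T →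
      |Gam d L s j x| ≤ M₁ * (ℓ ^ 2 / ℓ ^ d) * (s * ℓ ^ 2) ^ (-θ) := by
    intro s hs hsT
    have hs1 : s ≤ 1 := hsT.trans hT1
    have hσ1 : s * ℓ ^ 2 ≤ 1 := by
      have := mul_le_mul_of_nonneg_right hsT (sq_nonneg ℓ)
      rwa [hT, inv_mul_cancel₀ (by positivity)] at this
    have hσ0 : 0 < s * ℓ ^ 2 := by positivity
    have hR := abs_regular_le_of_small_mass hw₁ hL1 hℓ1 hs hs1 x
    have hJ := hJ₁ (s * ℓ ^ 2) hσ0 hσ1 L hL1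
    have hpow1 : 1 ≤ (s * ℓ ^ 2) ^ (-θ) :=
      Real.one_le_rpow_of_pos_of_le_one_of_nonpos hσ0 hσ1 (by linarith)
    have hSb : |(if j = 1 then ∫ t in Ioc 0 (1 / 2), wKer d s t x / t else 0)| ≤
        κ / 2 * (ℓ ^ 2 / ℓ ^ d) * (s * ℓ ^ 2) ^ (-θ) := by
      rcases eq_or_ne j 1 with h1 | h1
      · rw [if_pos h1, hfac1 h1, mul_one]
        exact ((hSle s hs h1).2).trans (le_mul_of_one_le_right (by positivity) hpow1)
      · rw [if_neg h1, abs_zero]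
        positivity
    rw [hGam s hs]
    calc |(∫ t in Ioc (ℓ / 2) (ℓ * L / 2), wKer d s t x / t) +
          (if j = 1 then ∫ t in Ioc 0 (1 / 2), wKer d s t x / t else 0)|
        ≤ |∫ t in Ioc (ℓ / 2) (ℓ * L / 2), wKer d s t x / t| +
          |(if j = 1 then ∫ t in Ioc 0 (1 / 2), wKer d s t x / t else 0)| := abs_add_le _ _
      _ ≤ c₁ * (ℓ ^ 2 / ℓ ^ d) * (K₁ * (s * ℓ ^ 2) ^ (-θ)) +
          κ / 2 * (ℓ ^ 2 / ℓ ^ d) * (s * ℓ ^ 2) ^ (-θ) := by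
          refine add_le_add (hR.trans ?_) hSb
          refine mul_le_mul_of_nonneg_left ?_ (by positivity)
          exact hJ
      _ = M₁ * (ℓ ^ 2 / ℓ ^ d) * (s * ℓ ^ 2) ^ (-θ) := by rw [hM₁]; ring
  -- (ii) `s ≤ 1`: (10.8) with `p = 2`
  have hG2 : ∀ s : ℝ, 0 < s → s ≤ 1 →
      |Gam d L s j x| ≤ M₂ * (ℓ ^ 2 / ℓ ^ d) * ((s * ℓ ^ 2) ^ 2)⁻¹ := by
    intro s hs hs1
    have hσ0 : 0 < s * ℓ ^ 2 := by positivity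
    have hR := abs_regular_le_of_small_mass hw₂ hL1 hℓ1 hs hs1 x
    have hJ := hJ₂ (s * ℓ ^ 2) hσ0 L hL1
    have hSb : |(if j = 1 then ∫ t in Ioc 0 (1 / 2), wKer d s t x / t else 0)| ≤
        κ / 2 * (ℓ ^ 2 / ℓ ^ d) * ((s * ℓ ^ 2) ^ 2)⁻¹ := by
      rcases eq_or_ne j 1 with h1 | h1
      · rw [if_pos h1, hfac1 h1, mul_one, hℓj h1]
        have hpow1 : 1 ≤ ((s * 1 ^ 2) ^ 2)⁻¹ := by
          rw [one_pow, mul_one, one_le_inv₀ (by positivity)]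
          exact pow_le_one₀ hs.le hs1
        exact ((hSle s hs h1).2).trans (le_mul_of_one_le_right (by positivity) hpow1)
      · rw [if_neg h1, abs_zero]
        positivity
    rw [hGam s hs]
    calc |(∫ t in Ioc (ℓ / 2) (ℓ * L / 2), wKer d s t x / t) +
          (if j = 1 then ∫ t in Ioc 0 (1 / 2), wKer d s t x / t else 0)|
        ≤ |∫ t in Ioc (ℓ / 2) (ℓ * L / 2), wKer d s t x / t| +
          |(if j = 1 then ∫ t in Ioc 0 (1 / 2), wKer d s t x / t else 0)| := abs_add_le _ _
      _ ≤ c₂ * (ℓ ^ 2 / ℓ ^ d) * (K₂ * ((s * ℓ ^ 2) ^ 2)⁻¹) +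
          κ / 2 * (ℓ ^ 2 / ℓ ^ d) * ((s * ℓ ^ 2) ^ 2)⁻¹ := by
          refine add_le_add (hR.trans ?_) hSb
          refine mul_le_mul_of_nonneg_left ?_ (by positivity)
          exact hJ
      _ = M₂ * (ℓ ^ 2 / ℓ ^ d) * ((s * ℓ ^ 2) ^ 2)⁻¹ := by rw [hM₂]; ring
  -- (iii) `s ≥ 1`: (10.8), third regime, with `2p₃ - 2 + α ≥ p'`
  have hG3 : ∀ s : ℝ, 1 ≤ s →
      |Gam d L s j x| ≤ M₃ * s⁻¹ * ((ℓ ^ (2 * p₃))⁻¹ * (ℓ ^ 2 / ℓ ^ d)) := by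
    intro s hs1
    have hs : 0 < s := by linarith
    have hR := abs_regular_le_of_large_mass hw₃ hL1 hℓ1 hs1 x
    have hJ := hJ₃ L hL1
    have hfac3 : 0 ≤ (ℓ ^ (2 * p₃))⁻¹ * (ℓ ^ 2 / ℓ ^ d) := by positivity
    have hSb : |(if j = 1 then ∫ t in Ioc 0 (1 / 2), wKer d s t x / t else 0)| ≤
        κ / 2 * s⁻¹ * ((ℓ ^ (2 * p₃))⁻¹ * (ℓ ^ 2 / ℓ ^ d)) := by
      rcases eq_or_ne j 1 with h1 | h1
      · rw [if_pos h1, hfac1 h1, mul_one, hℓj h1, one_pow, inv_one, mul_one]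
        exact (hSle s hs h1).1
      · rw [if_neg h1, abs_zero]
        positivity
    rw [hGam s hs]
    calc |(∫ t in Ioc (ℓ / 2) (ℓ * L / 2), wKer d s t x / t) +
          (if j = 1 then ∫ t in Ioc 0 (1 / 2), wKer d s t x / t else 0)|
        ≤ |∫ t in Ioc (ℓ / 2) (ℓ * L / 2), wKer d s t x / t| +
          |(if j = 1 then ∫ t in Ioc 0 (1 / 2), wKer d s t x / t else 0)| := abs_add_le _ _
      _ ≤ c₃ * s⁻¹ * ((ℓ ^ (2 * p₃))⁻¹ * (ℓ ^ 2 / ℓ ^ d)) * K₃ +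
          κ / 2 * s⁻¹ * ((ℓ ^ (2 * p₃))⁻¹ * (ℓ ^ 2 / ℓ ^ d)) :=
          add_le_add (hR.trans (mul_le_mul_of_nonneg_left hJ (by positivity))) hSb
      _ = M₃ * s⁻¹ * ((ℓ ^ (2 * p₃))⁻¹ * (ℓ ^ 2 / ℓ ^ d)) := by rw [hM₃]; ring
  -- Step 2: `|f| = |Γ_j| ρ` and the Kato bound (10.9)
  have hf_abs : ∀ s : ℝ, 0 < s → |f s| = |Gam d L s j x| * Kato.katoDensity (α / 2) m2 s :=
    fun s hs => by simp only [hf]; rw [abs_mul, abs_abs, abs_of_nonneg (hρ0 hs)]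
  have hfg : ∀ {s G X e : ℝ}, 0 < s → 0 ≤ G → |Gam d L s j x| ≤ G * X → X * s ^ β = s ^ e →
      |f s| ≤ G * cρ * (s ^ e / (s ^ β + A) ^ 2) := by
    intro s G X e hs hG hGX hX
    rw [hf_abs s hs]
    have hX0 : 0 ≤ G * X := (abs_nonneg _).trans hGX
    calc |Gam d L s j x| * Kato.katoDensity (α / 2) m2 s
        ≤ G * X * (cρ * (s ^ β / (s ^ β + A) ^ 2)) :=
          mul_le_mul hGX (hρ hm2 hs) (hρ0 hs) hX0
      _ = G * cρ * (X * s ^ β / (s ^ β + A) ^ 2) := by ring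
      _ = G * cρ * (s ^ e / (s ^ β + A) ^ 2) := by rw [hX]
  -- power counting
  have hℓ2 : 0 < ℓ ^ 2 := by positivity
  have hP1 : ∀ e₁ e₂ : ℝ, 2 + 2 * e₁ - 2 * e₂ - (d : ℝ) = α - d →
      ℓ ^ 2 / ℓ ^ d * (ℓ ^ 2) ^ e₁ * ((ℓ ^ 2)⁻¹) ^ e₂ = P := by
    intro e₁ e₂ he
    rw [rpow_combine hℓ0, he, hP]
  have hℓ2α : ℓ ^ (-(2 * α)) = (ℓ ^ α)⁻¹ ^ 2 := by
    rw [Real.rpow_neg hℓ0.le, inv_pow, ← Real.rpow_natCast (ℓ ^ α) 2, ← Real.rpow_mul hℓ0.le]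
    congr 1
    push_cast
    ring_nf
  have hP2 : ∀ e₁ e₂ : ℝ, 2 + 2 * e₁ - 2 * e₂ - (d : ℝ) = α - d - 2 * α →
      A⁻¹ ^ 2 * (ℓ ^ 2 / ℓ ^ d * (ℓ ^ 2) ^ e₁ * ((ℓ ^ 2)⁻¹) ^ e₂) = P * Aj⁻¹ ^ 2 := by
    intro e₁ e₂ he
    rw [rpow_combine hℓ0, he, sub_eq_add_neg (α - (d : ℝ)), Real.rpow_add hℓ0, hℓ2α, hAj,
      ← hP, mul_inv, mul_pow]
    ring
  -- piece 1: `(0, T]`, i.e. `T_{j,1}` (and `S_0` on `(0,T]` when `j = 1`)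
  obtain ⟨G₁, hG₁⟩ : ∃ G : ℝ, G = M₁ * ((ℓ ^ 2 / ℓ ^ d) * (ℓ ^ 2) ^ (-θ)) := ⟨_, rfl⟩
  have hG₁0 : 0 ≤ G₁ := by
    rw [hG₁]
    exact mul_nonneg hM₁0.le (mul_nonneg hfac (Real.rpow_nonneg hℓ2.le _))
  have hg1 : ∀ s ∈ Ioc (0 : ℝ) T, |f s| ≤ G₁ * cρ * (s ^ (β - θ) / (s ^ β + A) ^ 2) := by
    intro s hs
    refine hfg (X := s ^ (-θ)) hs.1 hG₁0 ?_ ?_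
    · have := hG1 s hs.1 hs.2
      rw [Real.mul_rpow hs.1.le hℓ2.le] at this
      calc |Gam d L s j x| ≤ M₁ * (ℓ ^ 2 / ℓ ^ d) * (s ^ (-θ) * (ℓ ^ 2) ^ (-θ)) := this
        _ = G₁ * s ^ (-θ) := by rw [hG₁]; ring
    · rw [← Real.rpow_add hs.1]
      congr 1
      ring
  have hγ1 : -1 < β - θ - 2 * β := by linarith
  have hi1 := CovBound.integrableOn_rpow_div_sq_Ioc hγ1 hm2 hT0.le
  have hpiece1 : |∫ s in Ioc 0 T, f s| ≤ 2 * (a₁ * P) / (1 + Aj ^ 2) := by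
    have hsub : Ioc (0 : ℝ) T ⊆ Ioi 0 := fun s hs => Set.mem_Ioi.2 hs.1
    have hgi : IntegrableOn (fun s : ℝ => G₁ * cρ * (s ^ (β - θ) / (s ^ β + A) ^ 2)) (Ioc 0 T) :=
      hi1.const_mul (G₁ * cρ)
    have hb0 := abs_setIntegral_le_of_abs_le (f := f) measurableSet_Ioc (hint.mono_set hsub) hgi hg1
    have he0 : ∫ s in Ioc 0 T, G₁ * cρ * (s ^ (β - θ) / (s ^ β + A) ^ 2) =
        G₁ * cρ * ∫ s in Ioc 0 T, s ^ (β - θ) / (s ^ β + A) ^ 2 := integral_const_mul _ _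
    have hb := hb0.trans_eq he0
    refine le_two_mul_div_one_add_sq (mul_nonneg ha₁0.le hP0.le) hAj0 ?_ ?_
    · have h1 := CovBound.setIntegral_rpow_div_sq_Ioc_le hγ1 hm2 hT0.le
      have hv : G₁ * cρ * (T ^ (β - θ - 2 * β + 1) / (β - θ - 2 * β + 1)) =
          M₁ * cρ * (1 / (1 - β - θ)) * P := by
        have := hP1 (-θ) (β - θ - 2 * β + 1) (by rw [hαβ]; ring)
        rw [hG₁, hT, ← this]
        have : β - θ - 2 * β + 1 = 1 - β - θ := by ring
        rw [this]
        ring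
      calc |∫ s in Ioc 0 T, f s| ≤ G₁ * cρ * ∫ s in Ioc 0 T, s ^ (β - θ) / (s ^ β + A) ^ 2 := hb
        _ ≤ G₁ * cρ * (T ^ (β - θ - 2 * β + 1) / (β - θ - 2 * β + 1)) :=
            mul_le_mul_of_nonneg_left h1 (mul_nonneg hG₁0 hcρ0.le)
        _ = M₁ * cρ * (1 / (1 - β - θ)) * P := hv
        _ ≤ a₁ * P := by
            refine mul_le_mul_of_nonneg_right ?_ hP0.le
            rw [ha₁]
            refine mul_le_mul_of_nonneg_left ?_ (mul_nonneg hM₁0.le hcρ0.le)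
            have : 0 ≤ 1 / (1 + β - θ) := one_div_nonneg.2 he₂.le
            linarith
    · intro hAjpos
      have hA0 : 0 < A := by
        rcases hm2.lt_or_eq with h | h
        · exact h
        · exfalso
          rw [hAj, ← h, zero_mul] at hAjpos
          exact lt_irrefl _ hAjpos
      have h1 := CovBound.setIntegral_rpow_div_sq_Ioc_le' (β := β) (γ := β - θ) (by linarith)
        hA0 hT0.le
      have hv : G₁ * cρ * (A⁻¹ ^ 2 * T ^ (β - θ + 1) / (β - θ + 1)) =
          M₁ * cρ * (1 / (1 + β - θ)) * (P * Aj⁻¹ ^ 2) := by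
        have := hP2 (-θ) (β - θ + 1) (by rw [hαβ]; ring)
        rw [hG₁, hT, ← this]
        have : β - θ + 1 = 1 + β - θ := by ring
        rw [this]
        ring
      calc |∫ s in Ioc 0 T, f s| ≤ G₁ * cρ * ∫ s in Ioc 0 T, s ^ (β - θ) / (s ^ β + A) ^ 2 := hb
        _ ≤ G₁ * cρ * (A⁻¹ ^ 2 * T ^ (β - θ + 1) / (β - θ + 1)) :=
            mul_le_mul_of_nonneg_left h1 (mul_nonneg hG₁0 hcρ0.le)
        _ = M₁ * cρ * (1 / (1 + β - θ)) * (P * Aj⁻¹ ^ 2) := hv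
        _ ≤ a₁ * (P * Aj⁻¹ ^ 2) := by
            refine mul_le_mul_of_nonneg_right ?_ (mul_nonneg hP0.le (sq_nonneg _))
            rw [ha₁]
            refine mul_le_mul_of_nonneg_left ?_ (mul_nonneg hM₁0.le hcρ0.le)
            have : 0 ≤ 1 / (1 - β - θ) := one_div_nonneg.2 he₁.le
            linarith
        _ = a₁ * P * Aj⁻¹ ^ 2 := by ring
  -- piece 2: `(T, 1]`, i.e. `T_{j,2}` with `p = 2`
  obtain ⟨G₂, hG₂⟩ : ∃ G : ℝ, G = M₂ * ((ℓ ^ 2 / ℓ ^ d) * (ℓ ^ 2) ^ (-2 : ℝ)) := ⟨_, rfl⟩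
  have hG₂0 : 0 ≤ G₂ := by
    rw [hG₂]
    exact mul_nonneg hM₂0.le (mul_nonneg hfac (Real.rpow_nonneg hℓ2.le _))
  have hg2 : ∀ s ∈ Ioc T 1, |f s| ≤ G₂ * cρ * (s ^ (β - 2) / (s ^ β + A) ^ 2) := by
    intro s hs
    have hs0 : 0 < s := lt_trans hT0 hs.1
    refine hfg (X := (s ^ 2)⁻¹) hs0 hG₂0 ?_ ?_
    · have := hG2 s hs0 hs.2
      calc |Gam d L s j x| ≤ M₂ * (ℓ ^ 2 / ℓ ^ d) * ((s * ℓ ^ 2) ^ 2)⁻¹ := this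
        _ = G₂ * (s ^ 2)⁻¹ := by
            rw [hG₂, Real.rpow_neg hℓ2.le, Real.rpow_two, mul_pow, mul_inv]
            ring
    · rw [← Real.rpow_two, ← Real.rpow_neg hs0.le, ← Real.rpow_add hs0]
      congr 1
      ring
  have hγ2 : β - 2 - 2 * β < -1 := by linarith
  have hi2 := CovBound.integrableOn_rpow_div_sq_Ioi hγ2 hm2 hT0
  have hnn2 : 0 ≤ᵐ[volume.restrict (Ioi T)] fun s : ℝ => s ^ (β - 2) / (s ^ β + A) ^ 2 := by
    refine (ae_restrict_iff' measurableSet_Ioi).2 (Eventually.of_forall fun s hs => ?_)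
    have hs0 : (0 : ℝ) < s := lt_trans hT0 (Set.mem_Ioi.1 hs)
    exact div_nonneg (Real.rpow_nonneg hs0.le _) (sq_nonneg _)
  have hpiece2 : |∫ s in Ioc T 1, f s| ≤ 2 * (a₂ * P) / (1 + Aj ^ 2) := by
    have hsub : Ioc T 1 ⊆ Ioi 0 := fun s hs => Set.mem_Ioi.2 (lt_trans hT0 hs.1)
    have hgi : IntegrableOn (fun s : ℝ => G₂ * cρ * (s ^ (β - 2) / (s ^ β + A) ^ 2)) (Ioc T 1) :=
      (hi2.mono_set Ioc_subset_Ioi_self).const_mul (G₂ * cρ)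
    have hb0 := abs_setIntegral_le_of_abs_le (f := f) measurableSet_Ioc (hint.mono_set hsub) hgi hg2
    have he0 : ∫ s in Ioc T 1, G₂ * cρ * (s ^ (β - 2) / (s ^ β + A) ^ 2) =
        G₂ * cρ * ∫ s in Ioc T 1, s ^ (β - 2) / (s ^ β + A) ^ 2 := integral_const_mul _ _
    have hb := hb0.trans_eq he0
    have hb' : |∫ s in Ioc T 1, f s| ≤ G₂ * cρ * ∫ s in Ioi T, s ^ (β - 2) / (s ^ β + A) ^ 2 :=
      hb.trans (mul_le_mul_of_nonneg_left (setIntegral_mono_set hi2 hnn2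
        Ioc_subset_Ioi_self.eventuallyLE) (mul_nonneg hG₂0 hcρ0.le))
    refine le_two_mul_div_one_add_sq (mul_nonneg ha₂0.le hP0.le) hAj0 ?_ ?_
    · have h1 := CovBound.setIntegral_rpow_div_sq_Ioi_le hγ2 hm2 hT0
      have hv : G₂ * cρ * (T ^ (β - 2 - 2 * β + 1) / (2 * β - (β - 2) - 1)) =
          M₂ * cρ * (1 / (β + 1)) * P := by
        have := hP1 (-2) (β - 2 - 2 * β + 1) (by rw [hαβ]; ring)
        rw [hG₂, hT, ← this]
        have : 2 * β - (β - 2) - 1 = β + 1 := by ring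
        rw [this]
        ring
      calc |∫ s in Ioc T 1, f s| ≤ G₂ * cρ * ∫ s in Ioi T, s ^ (β - 2) / (s ^ β + A) ^ 2 := hb'
        _ ≤ G₂ * cρ * (T ^ (β - 2 - 2 * β + 1) / (2 * β - (β - 2) - 1)) :=
            mul_le_mul_of_nonneg_left h1 (mul_nonneg hG₂0 hcρ0.le)
        _ = M₂ * cρ * (1 / (β + 1)) * P := hv
        _ ≤ a₂ * P := by
            refine mul_le_mul_of_nonneg_right ?_ hP0.le
            rw [ha₂]
            refine mul_le_mul_of_nonneg_left ?_ (mul_nonneg hM₂0.le hcρ0.le)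
            have : 0 ≤ 1 / (1 - β) := one_div_nonneg.2 he₃.le
            linarith
    · intro hAjpos
      have hA0 : 0 < A := by
        rcases hm2.lt_or_eq with h | h
        · exact h
        · exfalso
          rw [hAj, ← h, zero_mul] at hAjpos
          exact lt_irrefl _ hAjpos
      have h1 := CovBound.setIntegral_rpow_div_sq_Ioi_le' (β := β) (γ := β - 2) (by linarith)
        hA0 hT0
      have hv : G₂ * cρ * (A⁻¹ ^ 2 * T ^ (β - 2 + 1) / (-(β - 2) - 1)) =
          M₂ * cρ * (1 / (1 - β)) * (P * Aj⁻¹ ^ 2) := by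
        have := hP2 (-2) (β - 2 + 1) (by rw [hαβ]; ring)
        rw [hG₂, hT, ← this]
        have : -(β - 2) - 1 = 1 - β := by ring
        rw [this]
        ring
      calc |∫ s in Ioc T 1, f s| ≤ G₂ * cρ * ∫ s in Ioi T, s ^ (β - 2) / (s ^ β + A) ^ 2 := hb'
        _ ≤ G₂ * cρ * (A⁻¹ ^ 2 * T ^ (β - 2 + 1) / (-(β - 2) - 1)) :=
            mul_le_mul_of_nonneg_left h1 (mul_nonneg hG₂0 hcρ0.le)
        _ = M₂ * cρ * (1 / (1 - β)) * (P * Aj⁻¹ ^ 2) := hv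
        _ ≤ a₂ * (P * Aj⁻¹ ^ 2) := by
            refine mul_le_mul_of_nonneg_right ?_ (mul_nonneg hP0.le (sq_nonneg _))
            rw [ha₂]
            refine mul_le_mul_of_nonneg_left ?_ (mul_nonneg hM₂0.le hcρ0.le)
            have : 0 ≤ 1 / (β + 1) := one_div_nonneg.2 (by linarith)
            linarith
        _ = a₂ * P * Aj⁻¹ ^ 2 := by ring
  -- piece 3: `(1, ∞)`, i.e. `T_{j,3}` (and `S_0` on `(1,∞)` when `j = 1`)
  obtain ⟨G₃, hG₃⟩ : ∃ G : ℝ, G = M₃ * ((ℓ ^ (2 * p₃))⁻¹ * (ℓ ^ 2 / ℓ ^ d)) := ⟨_, rfl⟩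
  have hG₃0 : 0 ≤ G₃ := by
    rw [hG₃]
    exact mul_nonneg hM₃0.le (mul_nonneg (inv_nonneg.2 (pow_nonneg hℓ0.le _)) hfac)
  have hg3 : ∀ s ∈ Ioi (1 : ℝ), |f s| ≤ G₃ * cρ * (s ^ (β - 1) / (s ^ β + A) ^ 2) := by
    intro s hs
    have hs1 : (1 : ℝ) ≤ s := le_of_lt (Set.mem_Ioi.1 hs)
    have hs0 : 0 < s := lt_of_lt_of_le zero_lt_one hs1
    refine hfg (X := s⁻¹) hs0 hG₃0 ?_ ?_
    · calc |Gam d L s j x| ≤ M₃ * s⁻¹ * ((ℓ ^ (2 * p₃))⁻¹ * (ℓ ^ 2 / ℓ ^ d)) := hG3 s hs1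
        _ = G₃ * s⁻¹ := by rw [hG₃]; ring
    · rw [← Real.rpow_neg_one, ← Real.rpow_add hs0]
      congr 1
      ring
  have hγ3 : β - 1 - 2 * β < -1 := by linarith only [hβ0]
  have hi3 := CovBound.integrableOn_rpow_div_sq_Ioi hγ3 hm2 zero_lt_one
  have hpiece3 : |∫ s in Ioi 1, f s| ≤ a₃ * P * (1 / (1 + A * ℓ ^ p')) := by
    have hsub : Ioi (1 : ℝ) ⊆ Ioi 0 := fun s hs => Set.mem_Ioi.2 (lt_trans zero_lt_one (Set.mem_Ioi.1 hs))
    have hgi : IntegrableOn (fun s : ℝ => G₃ * cρ * (s ^ (β - 1) / (s ^ β + A) ^ 2)) (Ioi 1) :=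
      hi3.const_mul (G₃ * cρ)
    have hb0 := abs_setIntegral_le_of_abs_le (f := f) measurableSet_Ioi (hint.mono_set hsub) hgi hg3
    have he0 : ∫ s in Ioi (1 : ℝ), G₃ * cρ * (s ^ (β - 1) / (s ^ β + A) ^ 2) =
        G₃ * cρ * (1 / (β * (1 + A))) := by
      rw [← CovBound.setIntegral_rpow_sub_one_div_sq_Ioi hβ0 hm2]
      exact integral_const_mul _ _
    have hb := hb0.trans_eq he0
    have hq := rpow_neg_div_one_add_le (q := 2 * p₃ - 2 + α) hℓ1 hp' hp₃ hm2
    have hv : G₃ * cρ * (1 / (β * (1 + A))) = a₃ * P * (ℓ ^ (-(2 * p₃ - 2 + α)) / (1 + A)) := by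
      have hsp : ℓ ^ (2 - 2 * (p₃ : ℝ) - d : ℝ) = P * ℓ ^ (-(2 * p₃ - 2 + α)) := by
        rw [hP, ← Real.rpow_add hℓ0]
        congr 1
        ring
      rw [hG₃, pow_inv_mul_sq_div_pow hℓ0 p₃, hsp, ha₃, ← div_div]
      ring
    calc |∫ s in Ioi 1, f s| ≤ G₃ * cρ * (1 / (β * (1 + A))) := hb
      _ = a₃ * P * (ℓ ^ (-(2 * p₃ - 2 + α)) / (1 + A)) := hv
      _ ≤ a₃ * P * (1 / (1 + A * ℓ ^ p')) := mul_le_mul_of_nonneg_left hq (mul_nonneg ha₃0.le hP0.le)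
  -- Step 3: assemble
  rw [setIntegral_Ioi_eq_add_add hint hT0.le hT1]
  calc (∫ s in Ioc 0 T, f s) + (∫ s in Ioc T 1, f s) + ∫ s in Ioi 1, f s
      ≤ |∫ s in Ioc 0 T, f s| + |∫ s in Ioc T 1, f s| + |∫ s in Ioi 1, f s| :=
        add_le_add_three (le_abs_self _) (le_abs_self _) (le_abs_self _)
    _ ≤ (2 * a₁ + 2 * a₂ + a₃) * P * (1 / (1 + A ^ 2 * ℓ ^ (2 * α)) + 1 / (1 + A * ℓ ^ p')) :=
        hfinal hpiece1 hpiece2 hpiece3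

/-- **Slade, Proposition 3.3.1 (3.9) = Proposition 10.1.1 (10.3) with `a = 0`, on `ℤ^d`, in the
printed form**: `|C_{j;0,x}(m²)| ≤ c (L^{j-1})^{α-d} (1/(1+m⁴(L^{j-1})^{2α}) + 1/(1+m²(L^{j-1})^{p'}))`
for all `L ≥ 2`, `m² ≥ 0`, `j ≥ 1`, `x`, with `c` independent of `m², L, j, x`
(`|∫Γ_jρ| ≤ ∫|Γ_j|ρ` and `Slade2017_prop331_estimate_abs`).
[cite: Slade2017, Proposition 3.3.1 (display (3.9), a = 0)] [cite: Slade2017, §10.1 (Proposition 10.1.1, display (10.3), a = 0)] -/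
theorem Slade2017_prop331_estimate (hd : 1 ≤ d) {α : ℝ} (hα0 : 0 < α) (hα2 : α < 2)
    (hαd : α < d) {p' : ℝ} (hp' : 0 ≤ p') :
    ∃ c : ℝ, 0 < c ∧ ∀ L : ℝ, 2 ≤ L → ∀ m2 : ℝ, 0 ≤ m2 → ∀ j : ℕ, 1 ≤ j → ∀ x : Site d,
      |fracCov d L α m2 j x| ≤ c * (L ^ (j - 1)) ^ (α - d) *
        (1 / (1 + m2 ^ 2 * (L ^ (j - 1)) ^ (2 * α)) + 1 / (1 + m2 * (L ^ (j - 1)) ^ p')) := by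
  obtain ⟨c, hc, h⟩ := Slade2017_prop331_estimate_abs hd hα0 hα2 hαd hp'
  refine ⟨c, hc, fun L hL m2 hm2 j hj x => le_trans ?_ (h L hL m2 hm2 j hj x)⟩
  have hβ0 : 0 < α / 2 := by positivity
  have hβ1 : α / 2 < 1 := by linarith
  unfold fracCov
  refine abs_integral_le_integral_abs.trans (le_of_eq (setIntegral_congr_fun measurableSet_Ioi
    fun s hs => ?_))
  rw [abs_mul, abs_of_nonneg (Kato.katoDensity_pos hβ0 hβ1 m2 hs).le]

end FRD

end LongRangePhi4

end Literature.Barriers.CriticalPhenomena
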